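import Summits.QuantumFields.YangMills.Theses.UnitScaleTilt
import Summits.QuantumFields.YangMills.Theorems.UnitScaleTiltHistoryTailDensityTransfer
import Summits.QuantumFields.YangMills.Theorems.UnitScaleTiltHistoryTailSandwich

/-!
# Route `UnitScaleTilt` — crux K2 `HistoryTail` (stmt-QuantumFields-18916): THE ASSEMBLY OF MECHANISM A — the per-plaquette Gibbs tail of a
# block-averaged plaquette from (i) a (41)/(47)-type SANDWICH of the route's renormalised density and (ii) a NUMERATOR BOUND for the (41)
# majorant over the large-plaquette event; the two remaining inputs of `stub_perPlaquetteHighRaw` as explicit Lean hypotheses (support file)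

Fleet lead `ym-ust-18916-p1` (gen 0); split card `CARD-18916-K2-split.md` (evidence #12/#16).  After the owner's R2 ruling the active stub
`stub_perPlaquetteHighRaw` (birth v4, 2dd95f606719a12c) is K2's renormalisation-group content in raw currency.  Mechanism A (K2 memo §3 A) =
density transfer (S1, `HistoryTailDensityTransfer`, p439987) + sandwich-to-ratio (S4, `HistoryTailSandwich`, p440663) + numerator small factor
(S3, the `…StokesStep/Iter/SmallFactor/…Local/Remainder` files) + decoupling outside `N(p′)` (S5, unprinted) + budget (S6 = `stub_budget`, landed).
THIS FILE is the ASSEMBLY, with the two inputs that are NOT in the tree stated as explicit hypotheses in the route's own vocabulary — so that the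
WANTED socket `defn-AlphaInputsT3AC` (S2) and the future decoupling crux (S5) know the EXACT shapes they must deliver:

**`gibbsK_real_largePlaquette_le_of_sandwich`** — for the route's `j`-fold renormalised density `ρ_j = resDensity F γ K univ j`: IF
  (41′) `ρ_j(W) ≤ e^{−E+Rm}·up(W)` and (47′) `e^{−E−Rm}·low(W) ≤ ρ_j(W)` pointwise (`low ≥ 0`, `∫low > 0`; the shapes
  `HistoryTailSandwich.rho_le_of_ineq41` / `le_rho_of_ineq47` produce from `B10.Ineq41`/`B10.Ineq47`), and
  (NUM) `∫_{θ ≤ |W(∂p) − 1|} up ≤ B·∫ low` (S3 ⊕ S5: the small factor of the large plaquette AND the decoupling of the rest),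
  THEN `Gibbs_K{θ ≤ |Ū^{j}(∂p) − 1|} ≤ e^{2Rm}·B`.
With `B = exp(−¼p(g_{K−j})² + κ(1 + log g⁻¹)^{2+3r₀})` (S3 + S5; `B` need not be non-negative as a hypothesis) and `e^{2Rm_j} ≤ C` cutoff-uniform (memo caveat (v)) this IS the body of
`stub_perPlaquetteHighRaw` (`A = 0`); `stub_budget` then gives PP.

WHAT THIS IS NOT: (41′)/(47′) for `ρ_j` (S2) and (NUM) (S3-probabilistic ⊕ S5) are HYPOTHESES here; nothing uses (α).
-/

noncomputable section

open MeasureTheory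
open Literature.MathematicalPhysics.QuantumFieldTheory.Balaban1983to89
open Literature.MathematicalPhysics.QuantumFieldTheory.Balaban1983to89.T3ContinuumYM3Torus
open Literature.MathematicalPhysics.QuantumFieldTheory.Balaban1983to89.T3UnitScaleTilt
open Literature.MathematicalPhysics.QuantumFieldTheory.Balaban1983to89.T3UnitLawDensityEML
open Literature.MathematicalPhysics.QuantumFieldTheory.Balaban1983to89.T3RestrictedUnitDensity
open Literature.MathematicalPhysics.QuantumFieldTheory.Balaban1983to89.Missing (boltzmann partitionFn measurable_plaqHol)
open Summit.QuantumFields.YangMills.Theorems.HistoryTailDensityTransfer (gibbsK_real_largePlaquette_eq)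
open Summit.QuantumFields.YangMills.Theorems.HistoryTailSandwich (partitionFn_eq_integral_resDensity)

namespace Summit.QuantumFields.YangMills.Theorems.HistoryTailMechanismA

variable (F : T3Family) {γ : ℝ}

/-- **THE RATIO BOOKKEEPING FOR FUNCTIONS** (the content of `HistoryTailSandwich.ratio_le_of_ineq41_47` without the `TowerRun` carrier):
if `ρ ≤ e^{−E+Rm}·up` and `e^{−E−Rm}·low ≤ ρ` pointwise, `low ≥ 0`, `∫ low > 0`, and `∫_S up ≤ B·∫ low`, then `(∫_S ρ)/(∫ ρ) ≤ e^{2Rm}·B`.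
[cite: Balaban1985UV3, (41) p.266 and (47) p.267] -/
theorem setIntegral_div_integral_le {X : Type*} [MeasurableSpace X] (μ : Measure X) (S : Set X) (ρ up low : X → ℝ)
    (E Rm B : ℝ)
    (h41 : ∀ x, ρ x ≤ Real.exp (-E + Rm) * up x) (h47 : ∀ x, Real.exp (-E - Rm) * low x ≤ ρ x) (hlow0 : ∀ x, 0 ≤ low x)
    (hρ : Integrable ρ μ) (hup : IntegrableOn up S μ) (hlow : Integrable low μ)
    (hpos : 0 < ∫ x, low x ∂μ) (hnum : ∫ x in S, up x ∂μ ≤ B * ∫ x, low x ∂μ) :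
    (∫ x in S, ρ x ∂μ) / (∫ x, ρ x ∂μ) ≤ Real.exp (2 * Rm) * B := by
  set Lo : ℝ := ∫ x, low x ∂μ with hLo
  set N : ℝ := ∫ x in S, ρ x ∂μ with hN
  set D : ℝ := ∫ x, ρ x ∂μ with hD
  have hρ0 : ∀ x, 0 ≤ ρ x := fun x =>
    (mul_nonneg (Real.exp_nonneg _) (hlow0 x)).trans (h47 x)
  have hNle : N ≤ Real.exp (-E + Rm) * (B * Lo) := by
    calc N ≤ ∫ x in S, Real.exp (-E + Rm) * up x ∂μ := setIntegral_mono hρ.integrableOn (hup.const_mul _) fun x => h41 x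
      _ = Real.exp (-E + Rm) * ∫ x in S, up x ∂μ := integral_const_mul _ _
      _ ≤ Real.exp (-E + Rm) * (B * Lo) := mul_le_mul_of_nonneg_left hnum (Real.exp_nonneg _)
  have hDge : Real.exp (-E - Rm) * Lo ≤ D := by
    rw [hLo, hD, ← integral_const_mul]
    exact integral_mono (hlow.const_mul _) hρ fun x => h47 x
  have hN0 : 0 ≤ N := integral_nonneg fun x => hρ0 x
  have hD' : 0 < Real.exp (-E - Rm) * Lo := mul_pos (Real.exp_pos _) hpos
  calc N / D ≤ N / (Real.exp (-E - Rm) * Lo) := div_le_div_of_nonneg_left hN0 hD' hDge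
    _ ≤ Real.exp (-E + Rm) * (B * Lo) / (Real.exp (-E - Rm) * Lo) := div_le_div_of_nonneg_right hNle hD'.le
    _ = Real.exp (2 * Rm) * B := by
        have hsplit : Real.exp (-E + Rm) = Real.exp (2 * Rm) * Real.exp (-E - Rm) := by
          rw [← Real.exp_add]; ring_nf
        rw [hsplit]
        field_simp

/-- `∫ f·1_S = ∫_S f` for measurable `S`. [folklore] -/
theorem integral_mul_indicator_one_eq_setIntegral {X : Type*} [MeasurableSpace X] (μ : Measure X) {S : Set X}
    (hS : MeasurableSet S) (f : X → ℝ) :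
    ∫ x, f x * S.indicator 1 x ∂μ = ∫ x in S, f x ∂μ := by
  rw [← integral_indicator hS]
  refine integral_congr_ae (ae_of_all _ fun x => ?_)
  by_cases hx : x ∈ S
  · simp [Set.indicator_of_mem hx]
  · simp [Set.indicator_of_notMem hx]

/-- **MECHANISM A, ASSEMBLED**: for the route's `j`-fold renormalised density `ρ_j = resDensity F γ K univ j` (`j ≤ K`, `0 ≤ γ`), a
(41)/(47)-type sandwich `ρ_j ≤ e^{−E+Rm}·up`, `e^{−E−Rm}·low ≤ ρ_j` (`low ≥ 0`, `∫ low > 0`) and a numerator bound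
`∫_{θ ≤ |W(∂p)−1|} up ≤ B·∫ low` give the per-plaquette Gibbs tail `Gibbs_K{θ ≤ |Ū^{j}(∂p) − 1|} ≤ e^{2Rm}·B` — density transfer (S1), mass
identity `Z_K = ∫ρ_j`, and the ratio bookkeeping (S4).  (41′)/(47′) are what the WANTED socket `defn-AlphaInputsT3AC` must deliver for the `ℰp`
densities; the numerator bound is S3 (landed deterministic core) ⊕ S5 (decoupling, unprinted). [cite: Balaban1985UV3, (41) p.266, (47) p.267 and (71) p.273] -/
theorem gibbsK_real_largePlaquette_le_of_sandwich (hγ : 0 ≤ γ) {K j : ℕ} (hjK : j ≤ K) (p : Plaq (F.P K) j) (θ : ℝ)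
    (up low : GaugeField (F.P K) j (Matrix.specialUnitaryGroup (Fin 2) ℂ) → ℝ) (E Rm B : ℝ)
    (h41 : ∀ W, resDensity F γ K Set.univ j W ≤ Real.exp (-E + Rm) * up W)
    (h47 : ∀ W, Real.exp (-E - Rm) * low W ≤ resDensity F γ K Set.univ j W)
    (hlow0 : ∀ W, 0 ≤ low W)
    (hup : IntegrableOn up {W | θ ≤ GaugeGroup.dist1 (GaugeField.plaqHol W p)}
      (fieldMeasure (F.P K) j (Matrix.specialUnitaryGroup (Fin 2) ℂ)))
    (hlow : Integrable low (fieldMeasure (F.P K) j (Matrix.specialUnitaryGroup (Fin 2) ℂ)))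
    (hpos : 0 < ∫ W, low W ∂fieldMeasure (F.P K) j (Matrix.specialUnitaryGroup (Fin 2) ℂ))
    (hnum : ∫ W in {W | θ ≤ GaugeGroup.dist1 (GaugeField.plaqHol W p)}, up W
        ∂fieldMeasure (F.P K) j (Matrix.specialUnitaryGroup (Fin 2) ℂ) ≤
      B * ∫ W, low W ∂fieldMeasure (F.P K) j (Matrix.specialUnitaryGroup (Fin 2) ℂ)) :
    (gibbsK F ℰp γ K).real
        {U | θ ≤ GaugeGroup.dist1 (GaugeField.plaqHol (Averaging.iter (fun _ => BlockAveraging.blockAvg ℰp) j U) p)} ≤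
      Real.exp (2 * Rm) * B := by
  have hj : j ≤ F.m + K := hjK.trans (Nat.le_add_left K F.m)
  have hE : MeasurableSet {W : GaugeField (F.P K) j (Matrix.specialUnitaryGroup (Fin 2) ℂ) |
      θ ≤ GaugeGroup.dist1 (GaugeField.plaqHol W p)} :=
    measurableSet_le measurable_const (RegularGaugeGroup.measurable_dist1.comp (measurable_plaqHol p))
  -- S1 + the mass identity: the Gibbs mass is `(∫_E ρ_j)/(∫ ρ_j)`
  rw [gibbsK_real_largePlaquette_eq F hγ hj p θ, partitionFn_eq_integral_resDensity F hγ hj,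
    integral_mul_indicator_one_eq_setIntegral _ hE]
  exact setIntegral_div_integral_le _ _ _ up low E Rm B h41 h47 hlow0
    (integrable_resDensity F K MeasurableSet.univ hγ hj) hup hlow hpos hnum

end Summit.QuantumFields.YangMills.Theorems.HistoryTailMechanismA

end
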